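import Mathlib
import HarnessLib
import Summits.HubbardSuperconductivity.HubbardSuperconductivity.Theorems.KLProgrammeC4aCausticWindowCoverDispatch
import Summits.HubbardSuperconductivity.HubbardSuperconductivity.Theorems.KLProgrammeC4aCausticWindowDispatchPartnerBandLog

/-!
# Route `KLProgramme` — crux C4a, S3 brick (B4) «(U1)-LAWS» part 6b: the COVER THEOREM WITH THE LOGARITHMIC REMAINDER MAJORISED INTERNALLY — a fully explicit
# `n`-free bound per near-caustic ϑ-window of an umklapp sheet (twins of `…C4aCausticWindowCoverDispatch` §1/§3)

Cell `gate-hubbard-kl`, seat hubbard-kl-k3c3-p3 (g31; row «implicit-function / monotonicity route for μ(n)»).  Located brick for the (C)-closer lane / the (M4)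
assembly of the umklapp first-order ϑ-layer (stub (C) `stub_twoLeg_curvature` of `KLRegimeEngineV17F2`, stmt-HubbardSuperconductivity-20437), memo
HOME/hubbard-kl-k3c3-p3/U1-CAUSTIC-SUP.md §11.  Part 6a keys the antipodal window to the log dispatcher; this file lifts it through the shift-from-the-witness step
and the Gauss trichotomy of the cover theorem:
* **`intervalIntegral_caustic_antipodal_of_nearCaustic_log_le`** and the HEADLINE **`intervalIntegral_caustic_nearCaustic_umklapp_log_le`** — same hypotheses as
  p675052's theorems except that the pre/post laws carry `B′·log(Γ′/|δ₀|)` (and `|e_K| ≤ K₀ ≤ Γ′`) instead of a generic remainder; the conclusion has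
  `B′·2(Γ′/(κ₀/2))^{1/4}·8√(β − α)` in place of `∫R`.  With `…C4aFoldBoxPartnerBandLaws` (hFlaw), `…C4aFoldBoxPartnerBandPostLaws` (hpost) and `…C4aFoldBoxPreLaw`
  (hpre) every law hypothesis is one call for the actual partner band, so a near-caustic box of an umklapp sheet is now bounded by an explicit `n`-free number.
Composition of landed pieces; nothing new analytically; nothing asserts (C), K3 or superconductivity.
References: BGM 2003 §7.1 [cite: BenfattoGiulianiMastropietro2003]; FST II CPAM 51 (1998) §3 [cite: FeldmanSalmhoferTrubowitz1998].
-/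

noncomputable section

namespace Summit.HubbardSuperconductivity.HubbardSuperconductivity.Theorems.C4a

set_option linter.dupNamespace false -- summit = problem name (single-conjunct summit), D-0017

open Real Set Filter MeasureTheory intervalIntegral
open scoped Topology
open Literature.MathematicalPhysics.QuantumLattice Literature.MathematicalPhysics.QuantumLattice.BandSectorCounting Literature.Probability.LatticeModels
open Literature.MathematicalPhysics.QuantumLattice.FermiRG
open Summit.HubbardSuperconductivity.HubbardSuperconductivity.Theorems.KLRegimeSplit
open Summit.HubbardSuperconductivity.HubbardSuperconductivity.Theorems.DispersionFlow
open Summit.HubbardSuperconductivity.HubbardSuperconductivity.Theorems.PerturbedFermiCurve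

section Sizes

variable {K : TrigPolyC4v} {A : ℝ} (hA : ∀ p : Momentum, ∀ j ≤ 2, ‖iteratedFDeriv ℝ j (frameShift K) p‖ ≤ A) (hA20 : A ≤ 1 / 20)
  (hd : klCurveD ≤ (bandBounds (show (-4 : ℝ) < -1.1 by norm_num) (show (-1.1 : ℝ) ≤ -0.1 by norm_num)
    (show (-0.1 : ℝ) < 0 by norm_num)).Dtmin - 2 * A)
  {μ r : ℝ} (hr : 0 < r) (hlo : (-1.1 : ℝ) < μ - r - A) (hhi : μ + r + A < -0.1)
  {A₃ A₄ : ℝ} (hA₃ : ∀ p : Momentum, ‖iteratedFDeriv ℝ 3 (frameShift K) p‖ ≤ A₃)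
  (hA₄ : ∀ p : Momentum, ‖iteratedFDeriv ℝ 4 (frameShift K) p‖ ≤ A₄)
  {K₁ K₂ K₃ : ℝ} (hK₁ : ∀ p : Momentum, ‖fderiv ℝ (frameLevel μ K) p‖ ≤ K₁) (hK₂ : ∀ p : Momentum, ‖iteratedFDeriv ℝ 2 (frameLevel μ K) p‖ ≤ K₂)
  (hK₃ : ∀ p : Momentum, ‖iteratedFDeriv ℝ 3 (frameLevel μ K) p‖ ≤ K₃)
include hA hA20 hd hr hlo hhi hA₃ hA₄ hK₁ hK₂ hK₃

/-! ## §1 The antipodal window from the near-caustic witness -/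

/-- **THE ANTIPODAL NEAR-CAUSTIC WINDOW IN ONE CALL, LOGARITHMIC REMAINDER MAJORISED INTERNALLY** (twin of `intervalIntegral_caustic_antipodal_of_nearCaustic_le`:
the pre/post laws carry `B′·log(Γ′/|δ₀|)`, `|e_K| ≤ K₀ ≤ Γ′`; conclusion `(8A′ + 4P)/√(κ₀/2) + B(β − α) + B′·2(Γ′/(κ₀/2))^{1/4}·8√(β − α)`). -/
theorem intervalIntegral_caustic_antipodal_of_nearCaustic_log_le {R : RenConsts} {U : ℝ} {N : ℕ} (hF : FrameOK R U N μ K) {ρ : ℝ} (hρ : |ρ| < r)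
    (c : Momentum) (θ : ℝ) {α β φa φb ϑ₁ φ₁ τ₀ η₀ Δ ω : ℝ} (hαβ : α ≤ β) (hφ : φa ≤ φb) (hϑ₁ : ϑ₁ ∈ Icc α β) (hφ₁ : φ₁ ∈ Icc φa φb)
    (hτ : ‖c + (levelPoint μ K ρ (ϑ₁ + θ) - levelPoint μ K 0 (φ₁ + θ)) - levelPoint μ K 0 (φ₁ + θ)‖ ≤ τ₀)
    (hanti : torusDist (ϑ₁ - φ₁ - π) ≤ η₀)
    (hΔ : τ₀ + msD A₃ A₄ 1 * ((β - α) + (φb - φa)) ≤ Δ) (hω₁ : η₀ + (β - α) ≤ ω) (hω₂ : φb - φa ≤ ω)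
    (hbudget : 2 * (2 * K₃ * Δ * msD A₃ A₄ 1 ^ 2 +
        4 * K₂ * (radialRowOneConst A ((bandBounds (show (-4 : ℝ) < -1.1 by norm_num) (show (-1.1 : ℝ) ≤ -0.1 by norm_num) (show (-0.1 : ℝ) < 0 by norm_num)).Dtmin - 2 * A) * |ρ| +
          msD A₃ A₄ 2 * ω) * msD A₃ A₄ 1 +
        K₂ * Δ * msD A₃ A₄ 2 +
        K₁ * ((uRowTwoConst A A₃ ((bandBounds (show (-4 : ℝ) < -1.1 by norm_num) (show (-1.1 : ℝ) ≤ -0.1 by norm_num) (show (-0.1 : ℝ) < 0 by norm_num)).Dtmin - 2 * A) +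
              1 / ((bandBounds (show (-4 : ℝ) < -1.1 by norm_num) (show (-1.1 : ℝ) ≤ -0.1 by norm_num) (show (-0.1 : ℝ) < 0 by norm_num)).Dtmin - 2 * A) +
              2 * (radialRowOneConst A ((bandBounds (show (-4 : ℝ) < -1.1 by norm_num) (show (-1.1 : ℝ) ≤ -0.1 by norm_num) (show (-0.1 : ℝ) < 0 by norm_num)).Dtmin - 2 * A) -
                1 / ((bandBounds (show (-4 : ℝ) < -1.1 by norm_num) (show (-1.1 : ℝ) ≤ -0.1 by norm_num) (show (-0.1 : ℝ) < 0 by norm_num)).Dtmin - 2 * A))) * |ρ| +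
            msD A₃ A₄ 3 * ω)) <
      9 / 400 * (bandBounds (show (-4 : ℝ) < -1.1 by norm_num) (show (-1.1 : ℝ) ≤ -0.1 by norm_num) (show (-0.1 : ℝ) < 0 by norm_num)).umin ^ 2)
    {F : ℝ → ℝ} {lo A' P B B' Γ' K₀ : ℝ} (hlo' : 0 < lo) (hA' : 0 ≤ A') (hP : 0 ≤ P) (hB : 0 ≤ B) (hB' : 0 ≤ B')
    (hK₀ : ∀ p : Momentum, |frameLevel μ K p| ≤ K₀) (hK₀Γ : K₀ ≤ Γ')
    (hF0 : ∀ ϑ ∈ Icc α β, 0 ≤ F ϑ)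
    (hpre : ∀ ϑ ∈ Ioo α β, 0 < sInf ((fun φ => frameLevel μ K (c + (levelPoint μ K ρ (ϑ + θ) - levelPoint μ K 0 (φ + θ)))) '' Icc φa φb) →
      F ϑ ≤ A' * (lo * ((max |sInf ((fun φ => frameLevel μ K (c + (levelPoint μ K ρ (ϑ + θ) - levelPoint μ K 0 (φ + θ)))) '' Icc φa φb)| lo)⁻¹ *
        (Real.sqrt (max |sInf ((fun φ => frameLevel μ K (c + (levelPoint μ K ρ (ϑ + θ) - levelPoint μ K 0 (φ + θ)))) '' Icc φa φb)| lo))⁻¹)) + B + B' * Real.log (Γ' / |sInf ((fun φ => frameLevel μ K (c + (levelPoint μ K ρ (ϑ + θ) - levelPoint μ K 0 (φ + θ)))) '' Icc φa φb)|))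
    (hpost : ∀ ϑ ∈ Ioo α β, sInf ((fun φ => frameLevel μ K (c + (levelPoint μ K ρ (ϑ + θ) - levelPoint μ K 0 (φ + θ)))) '' Icc φa φb) < 0 →
      F ϑ ≤ P * (Real.sqrt |sInf ((fun φ => frameLevel μ K (c + (levelPoint μ K ρ (ϑ + θ) - levelPoint μ K 0 (φ + θ)))) '' Icc φa φb)|)⁻¹ + B + B' * Real.log (Γ' / |sInf ((fun φ => frameLevel μ K (c + (levelPoint μ K ρ (ϑ + θ) - levelPoint μ K 0 (φ + θ)))) '' Icc φa φb)|)) :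
    ∫ ϑ in α..β, F ϑ ≤ (8 * A' + 4 * P) / Real.sqrt ((9 / 400 * (bandBounds (show (-4 : ℝ) < -1.1 by norm_num) (show (-1.1 : ℝ) ≤ -0.1 by norm_num) (show (-0.1 : ℝ) < 0 by norm_num)).umin ^ 2 -
        2 * (2 * K₃ * Δ * msD A₃ A₄ 1 ^ 2 +
          4 * K₂ * (radialRowOneConst A ((bandBounds (show (-4 : ℝ) < -1.1 by norm_num) (show (-1.1 : ℝ) ≤ -0.1 by norm_num) (show (-0.1 : ℝ) < 0 by norm_num)).Dtmin - 2 * A) * |ρ| +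
            msD A₃ A₄ 2 * ω) * msD A₃ A₄ 1 +
          K₂ * Δ * msD A₃ A₄ 2 +
          K₁ * ((uRowTwoConst A A₃ ((bandBounds (show (-4 : ℝ) < -1.1 by norm_num) (show (-1.1 : ℝ) ≤ -0.1 by norm_num) (show (-0.1 : ℝ) < 0 by norm_num)).Dtmin - 2 * A) +
                1 / ((bandBounds (show (-4 : ℝ) < -1.1 by norm_num) (show (-1.1 : ℝ) ≤ -0.1 by norm_num) (show (-0.1 : ℝ) < 0 by norm_num)).Dtmin - 2 * A) +
                2 * (radialRowOneConst A ((bandBounds (show (-4 : ℝ) < -1.1 by norm_num) (show (-1.1 : ℝ) ≤ -0.1 by norm_num) (show (-0.1 : ℝ) < 0 by norm_num)).Dtmin - 2 * A) -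
                  1 / ((bandBounds (show (-4 : ℝ) < -1.1 by norm_num) (show (-1.1 : ℝ) ≤ -0.1 by norm_num) (show (-0.1 : ℝ) < 0 by norm_num)).Dtmin - 2 * A))) * |ρ| +
              msD A₃ A₄ 3 * ω))) / 2) +
      B * (β - α) + B' * (2 * (Γ' / ((9 / 400 * (bandBounds (show (-4 : ℝ) < -1.1 by norm_num) (show (-1.1 : ℝ) ≤ -0.1 by norm_num) (show (-0.1 : ℝ) < 0 by norm_num)).umin ^ 2 -
        2 * (2 * K₃ * Δ * msD A₃ A₄ 1 ^ 2 +
          4 * K₂ * (radialRowOneConst A ((bandBounds (show (-4 : ℝ) < -1.1 by norm_num) (show (-1.1 : ℝ) ≤ -0.1 by norm_num) (show (-0.1 : ℝ) < 0 by norm_num)).Dtmin - 2 * A) * |ρ| +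
            msD A₃ A₄ 2 * ω) * msD A₃ A₄ 1 +
          K₂ * Δ * msD A₃ A₄ 2 +
          K₁ * ((uRowTwoConst A A₃ ((bandBounds (show (-4 : ℝ) < -1.1 by norm_num) (show (-1.1 : ℝ) ≤ -0.1 by norm_num) (show (-0.1 : ℝ) < 0 by norm_num)).Dtmin - 2 * A) +
                1 / ((bandBounds (show (-4 : ℝ) < -1.1 by norm_num) (show (-1.1 : ℝ) ≤ -0.1 by norm_num) (show (-0.1 : ℝ) < 0 by norm_num)).Dtmin - 2 * A) +
                2 * (radialRowOneConst A ((bandBounds (show (-4 : ℝ) < -1.1 by norm_num) (show (-1.1 : ℝ) ≤ -0.1 by norm_num) (show (-0.1 : ℝ) < 0 by norm_num)).Dtmin - 2 * A) -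
                  1 / ((bandBounds (show (-4 : ℝ) < -1.1 by norm_num) (show (-1.1 : ℝ) ≤ -0.1 by norm_num) (show (-0.1 : ℝ) < 0 by norm_num)).Dtmin - 2 * A))) * |ρ| +
              msD A₃ A₄ 3 * ω))) / 2)) ^ (1 / 4 : ℝ)) * (8 * Real.sqrt (β - α)) := by
  -- the shift and the three rows
  obtain ⟨j, hΔ', hω₁', hω₂'⟩ := exists_antipodal_rows_of_nearCaustic hA hA20 hd hlo hhi hA₃ hA₄ hρ c θ hϑ₁ hφ₁ hτ hanti
  set ψ' : ℝ := φ₁ + θ + 2 * π * j with hψ'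
  have hφ' : φa + 2 * π * j ≤ φb + 2 * π * j := by linarith
  have hΔ'' : ∀ x ∈ Icc α β ×ˢ Icc (φa + 2 * π * j) (φb + 2 * π * j),
      ‖c + (levelPoint μ K ρ (x.1 + θ) - levelPoint μ K 0 (x.2 + θ)) - levelPoint μ K 0 ψ'‖ ≤ Δ := fun x hx => (hΔ' x hx).trans hΔ
  have hω₁'' : ∀ ϑ ∈ Icc α β, |ϑ + θ - (ψ' + π)| ≤ ω := fun ϑ hϑ => (hω₁' ϑ hϑ).trans hω₁
  have hω₂'' : ∀ φ ∈ Icc (φa + 2 * π * j) (φb + 2 * π * j), |φ + θ - ψ'| ≤ ω := fun φ hφ'' => (hω₂' φ hφ'').trans hω₂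
  -- the laws, keyed to the offset over the SHIFTED window (= the offset over the original window)
  have hshift : ∀ ϑ : ℝ, sInf ((fun φ => frameLevel μ K (c + (levelPoint μ K ρ (ϑ + θ) - levelPoint μ K 0 (φ + θ)))) '' Icc (φa + 2 * π * j) (φb + 2 * π * j)) =
      sInf ((fun φ => frameLevel μ K (c + (levelPoint μ K ρ (ϑ + θ) - levelPoint μ K 0 (φ + θ)))) '' Icc φa φb) := fun ϑ =>
    sInf_partnerBand_image_Icc_add_shift ρ c θ ϑ φa φb j
  have hpre' : ∀ ϑ ∈ Ioo α β, 0 < sInf ((fun φ => frameLevel μ K (c + (levelPoint μ K ρ (ϑ + θ) - levelPoint μ K 0 (φ + θ)))) '' Icc (φa + 2 * π * j) (φb + 2 * π * j)) →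
      F ϑ ≤ A' * (lo * ((max |sInf ((fun φ => frameLevel μ K (c + (levelPoint μ K ρ (ϑ + θ) - levelPoint μ K 0 (φ + θ)))) '' Icc (φa + 2 * π * j) (φb + 2 * π * j))| lo)⁻¹ *
        (Real.sqrt (max |sInf ((fun φ => frameLevel μ K (c + (levelPoint μ K ρ (ϑ + θ) - levelPoint μ K 0 (φ + θ)))) '' Icc (φa + 2 * π * j) (φb + 2 * π * j))| lo))⁻¹)) +
        B + B' * Real.log (Γ' / |sInf ((fun φ => frameLevel μ K (c + (levelPoint μ K ρ (ϑ + θ) - levelPoint μ K 0 (φ + θ)))) '' Icc (φa + 2 * π * j) (φb + 2 * π * j))|) := fun ϑ hϑ => by rw [hshift ϑ]; exact hpre ϑ hϑ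
  have hpost' : ∀ ϑ ∈ Ioo α β, sInf ((fun φ => frameLevel μ K (c + (levelPoint μ K ρ (ϑ + θ) - levelPoint μ K 0 (φ + θ)))) '' Icc (φa + 2 * π * j) (φb + 2 * π * j)) < 0 →
      F ϑ ≤ P * (Real.sqrt |sInf ((fun φ => frameLevel μ K (c + (levelPoint μ K ρ (ϑ + θ) - levelPoint μ K 0 (φ + θ)))) '' Icc (φa + 2 * π * j) (φb + 2 * π * j))|)⁻¹ +
        B + B' * Real.log (Γ' / |sInf ((fun φ => frameLevel μ K (c + (levelPoint μ K ρ (ϑ + θ) - levelPoint μ K 0 (φ + θ)))) '' Icc (φa + 2 * π * j) (φb + 2 * π * j))|) := fun ϑ hϑ => by rw [hshift ϑ]; exact hpost ϑ hϑ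
  exact intervalIntegral_caustic_dispatch_partnerBand_sInf_log_le hA hA20 hd hr hlo hhi hA₃ hA₄ hK₁ hK₂ hK₃ hF hρ c θ ψ' hαβ hφ' hΔ'' hω₁'' hω₂'' hbudget
    hlo' hA' hP hB hB' hK₀ hK₀Γ hF0 hpre' hpost'

/-! ## §2 The cover theorem -/

omit hr in
/-- **THE COVER THEOREM WITH THE LOGARITHMIC REMAINDER MAJORISED INTERNALLY** (twin of `intervalIntegral_caustic_nearCaustic_umklapp_le`): the pre/post laws
carry `B′·log(Γ′/|δ₀|)` (the remainder of part 5d's `hpre`; `|e_K| ≤ K₀ ≤ Γ′`), the two-sided law as before; THEN `∫_α^β F ≤ max(b_trans, b_anti)` with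
`b_anti = (8A′ + 4P)/√(κ₀/2) + B(β − α) + B′·2(Γ′/(κ₀/2))^{1/4}·8√(β − α)` — a FULLY EXPLICIT `n`-free bound per near-caustic window of an umklapp sheet; with parts
4a/4b/5d supplying `hFlaw`/`hpost`/`hpre` for the actual partner band, the (M4) assembly calls this once per box. -/
theorem intervalIntegral_caustic_nearCaustic_umklapp_log_le {R : RenConsts} {U : ℝ} {N : ℕ} (hF : FrameOK R U N μ K) {ρ : ℝ} (hρ : |ρ| < r) (hρ₀ : |ρ| < 3 / 80)
    (θ : ℝ) {m : Fin 2 → ℤ} (hm : m ≠ 0) {α β φa φb ϑ₁ φ₁ τ₀ η₀ Δ ω Γ A₁ : ℝ} (hαβ : α ≤ β) (hφ : φa ≤ φb) (hϑ₁ : ϑ₁ ∈ Icc α β) (hφ₁ : φ₁ ∈ Icc φa φb)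
    (hτ : ‖levelPoint μ K 0 θ - WithLp.toLp 2 (fun i => 2 * π * (m i : ℝ)) + (levelPoint μ K ρ (ϑ₁ + θ) - levelPoint μ K 0 (φ₁ + θ)) -
      levelPoint μ K 0 (φ₁ + θ)‖ ≤ τ₀)
    (hsame : τ₀ + 2 * (msD A₃ A₄ 1 * η₀ + |ρ| / ((bandBounds (show (-4 : ℝ) < -1.1 by norm_num) (show (-1.1 : ℝ) ≤ -0.1 by norm_num) (show (-0.1 : ℝ) < 0 by norm_num)).Dtmin - 2 * A)) ≤ 3 / 5)
    (hΔ : τ₀ + msD A₃ A₄ 1 * ((β - α) + (φb - φa)) ≤ Δ) (hΔ1 : Δ ≤ 3 / 10) (hΔr : K₁ * Δ < r) (hω₁ : η₀ + (β - α) ≤ ω) (hω₂ : φb - φa ≤ ω)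
    (hκ : 0 < 2 / π * (((bandBounds (show (-4 : ℝ) < -1.1 by norm_num) (show (-1.1 : ℝ) ≤ -0.1 by norm_num) (show (-0.1 : ℝ) < 0 by norm_num)).Dtmin - 2 * A) * (bandBounds (show (-4 : ℝ) < -1.1 by norm_num) (show (-1.1 : ℝ) ≤ -0.1 by norm_num) (show (-0.1 : ℝ) < 0 by norm_num)).umin) *
      ((bandBounds (show (-4 : ℝ) < -1.1 by norm_num) (show (-1.1 : ℝ) ≤ -0.1 by norm_num) (show (-0.1 : ℝ) < 0 by norm_num)).umin * (3 / 200) / (4 + 2 * A) * (η₀ - (β - α) - π / (2 * (bandBounds (show (-4 : ℝ) < -1.1 by norm_num) (show (-1.1 : ℝ) ≤ -0.1 by norm_num) (show (-0.1 : ℝ) < 0 by norm_num)).umin) * Δ) - π * 7 * (K₁ * Δ + |ρ|) / ((bandBounds (show (-4 : ℝ) < -1.1 by norm_num) (show (-1.1 : ℝ) ≤ -0.1 by norm_num) (show (-0.1 : ℝ) < 0 by norm_num)).Dtmin - 2 * A) ^ 2))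
    (hΓ : 2 / π * (((bandBounds (show (-4 : ℝ) < -1.1 by norm_num) (show (-1.1 : ℝ) ≤ -0.1 by norm_num) (show (-0.1 : ℝ) < 0 by norm_num)).Dtmin - 2 * A) * (bandBounds (show (-4 : ℝ) < -1.1 by norm_num) (show (-1.1 : ℝ) ≤ -0.1 by norm_num) (show (-0.1 : ℝ) < 0 by norm_num)).umin) *
      ((bandBounds (show (-4 : ℝ) < -1.1 by norm_num) (show (-1.1 : ℝ) ≤ -0.1 by norm_num) (show (-0.1 : ℝ) < 0 by norm_num)).umin * (3 / 200) / (4 + 2 * A) * (η₀ - (β - α) - π / (2 * (bandBounds (show (-4 : ℝ) < -1.1 by norm_num) (show (-1.1 : ℝ) ≤ -0.1 by norm_num) (show (-0.1 : ℝ) < 0 by norm_num)).umin) * Δ) - π * 7 * (K₁ * Δ + |ρ|) / ((bandBounds (show (-4 : ℝ) < -1.1 by norm_num) (show (-1.1 : ℝ) ≤ -0.1 by norm_num) (show (-0.1 : ℝ) < 0 by norm_num)).Dtmin - 2 * A) ^ 2) * (β - α) ≤ Γ)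
    (hbudget : 2 * (2 * K₃ * Δ * msD A₃ A₄ 1 ^ 2 +
        4 * K₂ * (radialRowOneConst A ((bandBounds (show (-4 : ℝ) < -1.1 by norm_num) (show (-1.1 : ℝ) ≤ -0.1 by norm_num) (show (-0.1 : ℝ) < 0 by norm_num)).Dtmin - 2 * A) * |ρ| + msD A₃ A₄ 2 * ω) * msD A₃ A₄ 1 +
        K₂ * Δ * msD A₃ A₄ 2 +
        K₁ * ((uRowTwoConst A A₃ ((bandBounds (show (-4 : ℝ) < -1.1 by norm_num) (show (-1.1 : ℝ) ≤ -0.1 by norm_num) (show (-0.1 : ℝ) < 0 by norm_num)).Dtmin - 2 * A) + 1 / ((bandBounds (show (-4 : ℝ) < -1.1 by norm_num) (show (-1.1 : ℝ) ≤ -0.1 by norm_num) (show (-0.1 : ℝ) < 0 by norm_num)).Dtmin - 2 * A) +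
              2 * (radialRowOneConst A ((bandBounds (show (-4 : ℝ) < -1.1 by norm_num) (show (-1.1 : ℝ) ≤ -0.1 by norm_num) (show (-0.1 : ℝ) < 0 by norm_num)).Dtmin - 2 * A) - 1 / ((bandBounds (show (-4 : ℝ) < -1.1 by norm_num) (show (-1.1 : ℝ) ≤ -0.1 by norm_num) (show (-0.1 : ℝ) < 0 by norm_num)).Dtmin - 2 * A))) * |ρ| + msD A₃ A₄ 3 * ω)) < 9 / 400 * (bandBounds (show (-4 : ℝ) < -1.1 by norm_num) (show (-1.1 : ℝ) ≤ -0.1 by norm_num) (show (-0.1 : ℝ) < 0 by norm_num)).umin ^ 2)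
    {F : ℝ → ℝ} {lo A' P B B' Γ' K₀ : ℝ} (hlo' : 0 < lo) (hA' : 0 ≤ A') (hP : 0 ≤ P) (hB : 0 ≤ B) (hA₁ : 0 ≤ A₁) (hB' : 0 ≤ B')
    (hK₀ : ∀ p : Momentum, |frameLevel μ K p| ≤ K₀) (hK₀Γ : K₀ ≤ Γ')
    (hF0 : ∀ ϑ ∈ Icc α β, 0 ≤ F ϑ)
    (hFlaw : ∀ ϑ ∈ Ioo α β, sInf ((fun φ => frameLevel μ K (levelPoint μ K 0 θ - WithLp.toLp 2 (fun i => 2 * π * (m i : ℝ)) + (levelPoint μ K ρ (ϑ + θ) - levelPoint μ K 0 (φ + θ)))) '' Icc φa φb) ≠ 0 →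
      F ϑ ≤ A₁ * ((1 + log⁺ (Γ / |sInf ((fun φ => frameLevel μ K (levelPoint μ K 0 θ - WithLp.toLp 2 (fun i => 2 * π * (m i : ℝ)) + (levelPoint μ K ρ (ϑ + θ) - levelPoint μ K 0 (φ + θ)))) '' Icc φa φb)|)) ^ 2 * (1 + (Real.sqrt |sInf ((fun φ => frameLevel μ K (levelPoint μ K 0 θ - WithLp.toLp 2 (fun i => 2 * π * (m i : ℝ)) + (levelPoint μ K ρ (ϑ + θ) - levelPoint μ K 0 (φ + θ)))) '' Icc φa φb)|)⁻¹)))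
    (hpre : ∀ ϑ ∈ Ioo α β, 0 < sInf ((fun φ => frameLevel μ K (levelPoint μ K 0 θ - WithLp.toLp 2 (fun i => 2 * π * (m i : ℝ)) + (levelPoint μ K ρ (ϑ + θ) - levelPoint μ K 0 (φ + θ)))) '' Icc φa φb) →
      F ϑ ≤ A' * (lo * ((max |sInf ((fun φ => frameLevel μ K (levelPoint μ K 0 θ - WithLp.toLp 2 (fun i => 2 * π * (m i : ℝ)) + (levelPoint μ K ρ (ϑ + θ) - levelPoint μ K 0 (φ + θ)))) '' Icc φa φb)| lo)⁻¹ * (Real.sqrt (max |sInf ((fun φ => frameLevel μ K (levelPoint μ K 0 θ - WithLp.toLp 2 (fun i => 2 * π * (m i : ℝ)) + (levelPoint μ K ρ (ϑ + θ) - levelPoint μ K 0 (φ + θ)))) '' Icc φa φb)| lo))⁻¹)) + B + B' * Real.log (Γ' / |sInf ((fun φ => frameLevel μ K (levelPoint μ K 0 θ - WithLp.toLp 2 (fun i => 2 * π * (m i : ℝ)) + (levelPoint μ K ρ (ϑ + θ) - levelPoint μ K 0 (φ + θ)))) '' Icc φa φb)|))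
    (hpost : ∀ ϑ ∈ Ioo α β, sInf ((fun φ => frameLevel μ K (levelPoint μ K 0 θ - WithLp.toLp 2 (fun i => 2 * π * (m i : ℝ)) + (levelPoint μ K ρ (ϑ + θ) - levelPoint μ K 0 (φ + θ)))) '' Icc φa φb) < 0 →
      F ϑ ≤ P * (Real.sqrt |sInf ((fun φ => frameLevel μ K (levelPoint μ K 0 θ - WithLp.toLp 2 (fun i => 2 * π * (m i : ℝ)) + (levelPoint μ K ρ (ϑ + θ) - levelPoint μ K 0 (φ + θ)))) '' Icc φa φb)|)⁻¹ + B + B' * Real.log (Γ' / |sInf ((fun φ => frameLevel μ K (levelPoint μ K 0 θ - WithLp.toLp 2 (fun i => 2 * π * (m i : ℝ)) + (levelPoint μ K ρ (ϑ + θ) - levelPoint μ K 0 (φ + θ)))) '' Icc φa φb)|)) :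
    ∫ ϑ in α..β, F ϑ ≤ max (2 * (A₁ * max 1 (Real.sqrt (2 / π * (((bandBounds (show (-4 : ℝ) < -1.1 by norm_num) (show (-1.1 : ℝ) ≤ -0.1 by norm_num) (show (-0.1 : ℝ) < 0 by norm_num)).Dtmin - 2 * A) * (bandBounds (show (-4 : ℝ) < -1.1 by norm_num) (show (-1.1 : ℝ) ≤ -0.1 by norm_num) (show (-0.1 : ℝ) < 0 by norm_num)).umin) *
      ((bandBounds (show (-4 : ℝ) < -1.1 by norm_num) (show (-1.1 : ℝ) ≤ -0.1 by norm_num) (show (-0.1 : ℝ) < 0 by norm_num)).umin * (3 / 200) / (4 + 2 * A) * (η₀ - (β - α) - π / (2 * (bandBounds (show (-4 : ℝ) < -1.1 by norm_num) (show (-1.1 : ℝ) ≤ -0.1 by norm_num) (show (-0.1 : ℝ) < 0 by norm_num)).umin) * Δ) - π * 7 * (K₁ * Δ + |ρ|) / ((bandBounds (show (-4 : ℝ) < -1.1 by norm_num) (show (-1.1 : ℝ) ≤ -0.1 by norm_num) (show (-0.1 : ℝ) < 0 by norm_num)).Dtmin - 2 * A) ^ 2)))⁻¹ * (81 * (Γ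 / (2 / π * (((bandBounds (show (-4 : ℝ) < -1.1 by norm_num) (show (-1.1 : ℝ) ≤ -0.1 by norm_num) (show (-0.1 : ℝ) < 0 by norm_num)).Dtmin - 2 * A) * (bandBounds (show (-4 : ℝ) < -1.1 by norm_num) (show (-1.1 : ℝ) ≤ -0.1 by norm_num) (show (-0.1 : ℝ) < 0 by norm_num)).umin) *
      ((bandBounds (show (-4 : ℝ) < -1.1 by norm_num) (show (-1.1 : ℝ) ≤ -0.1 by norm_num) (show (-0.1 : ℝ) < 0 by norm_num)).umin * (3 / 200) / (4 + 2 * A) * (η₀ - (β - α) - π / (2 * (bandBounds (show (-4 : ℝ) < -1.1 by norm_num) (show (-1.1 : ℝ) ≤ -0.1 by norm_num) (show (-0.1 : ℝ) < 0 by norm_num)).umin) * Δ) - π * 7 * (K₁ * Δ + |ρ|) / ((bandBounds (show (-4 : ℝ) < -1.1 by norm_num) (show (-1.1 : ℝ) ≤ -0.1 by norm_num) (show (-0.1 : ℝ) < 0 by norm_num)).Dtmin - 2 * A) ^ 2))) ^ (1 / 4 : ℝ)) *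
          ((β - α) ^ (3 / 4 : ℝ) / (3 / 4) + (β - α) ^ (1 / 4 : ℝ) / (1 / 4))))
      ((8 * A' + 4 * P) / Real.sqrt ((9 / 400 * (bandBounds (show (-4 : ℝ) < -1.1 by norm_num) (show (-1.1 : ℝ) ≤ -0.1 by norm_num) (show (-0.1 : ℝ) < 0 by norm_num)).umin ^ 2 - 2 * (2 * K₃ * Δ * msD A₃ A₄ 1 ^ 2 +
        4 * K₂ * (radialRowOneConst A ((bandBounds (show (-4 : ℝ) < -1.1 by norm_num) (show (-1.1 : ℝ) ≤ -0.1 by norm_num) (show (-0.1 : ℝ) < 0 by norm_num)).Dtmin - 2 * A) * |ρ| + msD A₃ A₄ 2 * ω) * msD A₃ A₄ 1 +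
        K₂ * Δ * msD A₃ A₄ 2 +
        K₁ * ((uRowTwoConst A A₃ ((bandBounds (show (-4 : ℝ) < -1.1 by norm_num) (show (-1.1 : ℝ) ≤ -0.1 by norm_num) (show (-0.1 : ℝ) < 0 by norm_num)).Dtmin - 2 * A) + 1 / ((bandBounds (show (-4 : ℝ) < -1.1 by norm_num) (show (-1.1 : ℝ) ≤ -0.1 by norm_num) (show (-0.1 : ℝ) < 0 by norm_num)).Dtmin - 2 * A) +
              2 * (radialRowOneConst A ((bandBounds (show (-4 : ℝ) < -1.1 by norm_num) (show (-1.1 : ℝ) ≤ -0.1 by norm_num) (show (-0.1 : ℝ) < 0 by norm_num)).Dtmin - 2 * A) - 1 / ((bandBounds (show (-4 : ℝ) < -1.1 by norm_num) (show (-1.1 : ℝ) ≤ -0.1 by norm_num) (show (-0.1 : ℝ) < 0 by norm_num)).Dtmin - 2 * A))) * |ρ| + msD A₃ A₄ 3 * ω))) / 2) + B * (β - α) +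
        B' * (2 * (Γ' / ((9 / 400 * (bandBounds (show (-4 : ℝ) < -1.1 by norm_num) (show (-1.1 : ℝ) ≤ -0.1 by norm_num) (show (-0.1 : ℝ) < 0 by norm_num)).umin ^ 2 - 2 * (2 * K₃ * Δ * msD A₃ A₄ 1 ^ 2 +
        4 * K₂ * (radialRowOneConst A ((bandBounds (show (-4 : ℝ) < -1.1 by norm_num) (show (-1.1 : ℝ) ≤ -0.1 by norm_num) (show (-0.1 : ℝ) < 0 by norm_num)).Dtmin - 2 * A) * |ρ| + msD A₃ A₄ 2 * ω) * msD A₃ A₄ 1 +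
        K₂ * Δ * msD A₃ A₄ 2 +
        K₁ * ((uRowTwoConst A A₃ ((bandBounds (show (-4 : ℝ) < -1.1 by norm_num) (show (-1.1 : ℝ) ≤ -0.1 by norm_num) (show (-0.1 : ℝ) < 0 by norm_num)).Dtmin - 2 * A) + 1 / ((bandBounds (show (-4 : ℝ) < -1.1 by norm_num) (show (-1.1 : ℝ) ≤ -0.1 by norm_num) (show (-0.1 : ℝ) < 0 by norm_num)).Dtmin - 2 * A) +
              2 * (radialRowOneConst A ((bandBounds (show (-4 : ℝ) < -1.1 by norm_num) (show (-1.1 : ℝ) ≤ -0.1 by norm_num) (show (-0.1 : ℝ) < 0 by norm_num)).Dtmin - 2 * A) - 1 / ((bandBounds (show (-4 : ℝ) < -1.1 by norm_num) (show (-1.1 : ℝ) ≤ -0.1 by norm_num) (show (-0.1 : ℝ) < 0 by norm_num)).Dtmin - 2 * A))) * |ρ| + msD A₃ A₄ 3 * ω))) / 2)) ^ (1 / 4 : ℝ)) * (8 * Real.sqrt (β - α))) := by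
  set c : Momentum := levelPoint μ K 0 θ - WithLp.toLp 2 (fun i => 2 * π * (m i : ℝ)) with hc
  have hr' : 0 < r := lt_of_le_of_lt (abs_nonneg ρ) hρ
  rcases le_or_gt (torusDist (ϑ₁ - φ₁)) η₀ with hs | hs
  · -- same direction: empty
    exfalso
    have hτ' : ‖pairSumPath μ K ρ ϑ₁ θ 0 - WithLp.toLp 2 (fun i => 2 * π * (m i : ℝ)) - (2 : ℝ) • levelPoint μ K 0 (φ₁ + θ)‖ ≤ τ₀ := by
      have e : pairSumPath μ K ρ ϑ₁ θ 0 - WithLp.toLp 2 (fun i => 2 * π * (m i : ℝ)) - (2 : ℝ) • levelPoint μ K 0 (φ₁ + θ) =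
          c + (levelPoint μ K ρ (ϑ₁ + θ) - levelPoint μ K 0 (φ₁ + θ)) - levelPoint μ K 0 (φ₁ + θ) := by
        simp only [pairSumPath, add_zero, two_smul, hc]; abel
      rw [e]; exact hτ
    exact not_nearCaustic_sameDirection hA hA20 hd hr' hlo hhi hA₃ hA₄ hρ θ hm hτ' hs hsame
  rcases le_or_gt (torusDist (ϑ₁ - φ₁ - π)) η₀ with ha | ha
  · -- antipodal
    exact le_max_of_le_right (intervalIntegral_caustic_antipodal_of_nearCaustic_log_le hA hA20 hd hr' hlo hhi hA₃ hA₄ hK₁ hK₂ hK₃ hF hρ c θ hαβ hφ hϑ₁ hφ₁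
      hτ ha hΔ hω₁ hω₂ hbudget hlo' hA' hP hB hB' hK₀ hK₀Γ hF0 hpre hpost)
  · -- transversal
    have htrans : η₀ ≤ min (torusDist (ϑ₁ - φ₁)) (torusDist (ϑ₁ - φ₁ - π)) := le_min hs.le ha.le
    exact le_max_of_le_left (intervalIntegral_caustic_transversal_of_nearCaustic_le hA hA20 hd hlo hhi hA₃ hA₄ hK₁ hF.1 hρ hρ₀ c θ hαβ hφ hϑ₁ hφ₁
      hτ htrans hΔ hΔ1 hΔr hκ hΓ hA₁ hF0 hFlaw)

end Sizes

end Summit.HubbardSuperconductivity.HubbardSuperconductivity.Theorems.C4a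

end
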